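import Summits.ValiantsHypothesis.ValiantsHypothesis.Theses.DivisionGap
import Summits.ValiantsHypothesis.ValiantsHypothesis.Theorems.DivisionGapDefs
import Summits.ValiantsHypothesis.ValiantsHypothesis.Theorems.DivisionGapPerDivisionHardStubTorusSupport
import Summits.ValiantsHypothesis.ValiantsHypothesis.Theorems.DivisionGapPerDivisionHardStubFaceDescent
import Summits.ValiantsHypothesis.ValiantsHypothesis.Theorems.DivisionGapPerDivisionHardStubJssContraction
import Summits.ValiantsHypothesis.ValiantsHypothesis.Theorems.DivisionGapPerDivisionHardStubBlockArsenal
import Summits.ValiantsHypothesis.ValiantsHypothesis.Theorems.DivisionGapPerDivisionHardStubSubexpRigid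

/-!
# Crux `DivisionGap.PerDivisionHard` (stmt-ValiantsHypothesis-5065) — the SUB-EXPONENTIAL SPARSE RUNG

`PerDivisionHard` asks, for every `c` and all large `n`, that every nonzero cofactor
`h ∈ ℝ≥0[x_ij]` satisfies `2^{(log₂ n + c)^c} < L(per_n · h) + L(h)` (monotone fan-in-two
`complexity` over `ℝ≥0`).  This file proves it for all cofactors with at most
`2^{n / (log₂ n + e)^e}` MONOMIALS (`e = e(c)`), of arbitrary degree and cost:

* `perDivisionHard_subexpSparse` — **∀ c, ∃ e n₀, ∀ n ≥ n₀, ∀ h ≠ 0 with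
  `|supp h| ≤ 2^{n / (log₂ n + e)^e}`: `2^{(log₂ n + c)^c} < L(per_n · h) + L(h)`.**

It extends the quasi-polynomial count of the v2 sparse rung
(`Theorems/DivisionGapPerDivisionHardSparse.lean`, `|supp h| ≤ 2^{(log₂ n + c)^c}`) by using the
slack the line never needed: the subdivision length `k` of the placed block `G(b,k) ⊕ M₀` may be as
large as `n / polylog` (`stub_subexpRigid`, skeleton v7.1 of line `pair-descent-jss-endpoint`,
`Cruxes/PerDivisionHard/Lines/pair_descent_jss_endpoint.lean`), since the face hardness needs only
`b ≥ (log₂ n + d)^d` and the girth substitute gives `≥ 4k + 2` block rows for every `k`.  The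
composition is verbatim that of the sparse rung: torus normal form keeping a sub-support
(`stub_torusSupport`) → rigid placement (`stub_subexpRigid`) → face descent (`stub_faceDescent`) →
Jukna–Seiwert–Sergeev contraction (`stub_jssContraction`) → hardness of the placed face
(`stub_blockArsenal`).  Examples now covered: every `h` on at most `n / polylog` variables,
`∏_{i ≤ n/polylog} (x_{i,1} + x_{i,2})`, `per_t ⊗ x^{pad}` with `t = n / polylog²`.
-/

noncomputable section

-- `Summit.ValiantsHypothesis.ValiantsHypothesis.…` is the tree's mandated single-conjunct layout
-- (Sub = Summit), so the duplicated namespace component is intended.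
set_option linter.dupNamespace false

namespace Summit.ValiantsHypothesis.ValiantsHypothesis.Theorems.DivisionGapPerDivisionHard

open MvPolynomial Literature.Computability.AlgebraicComplexity
open scoped NNReal

/-- **The sub-exponential sparse rung of `PerDivisionHard`.**  For every `c` there are `e, n₀`
such that for all `n ≥ n₀` and every nonzero `h ∈ ℝ≥0[x_ij]` (`n × n` matrix variables) with at
most `2^{n / (log₂ n + e)^e}` monomials, `2^{(log₂ n + c)^c} < L(per_n · h) + L(h)` in the monotone
fan-in-two `complexity` over `ℝ≥0`.  Composition of the landed stubs of line
`pair-descent-jss-endpoint` (torus normal form with sub-support, rigidity of a placed subdivided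
block face with long subdivision paths, face descent, Jukna–Seiwert–Sergeev contraction, hardness
of the block face). [folklore] -/
theorem perDivisionHard_subexpSparse :
    ∀ c : ℕ, ∃ e n₀ : ℕ, ∀ n ≥ n₀, ∀ h : MvPolynomial (Fin n × Fin n) ℝ≥0, h ≠ 0 →
      h.support.card ≤ 2 ^ (n / (Nat.log 2 n + e) ^ e) →
      2 ^ ((Nat.log 2 n + c) ^ c) <
        complexity (perPoly (Fin n) ℝ≥0 * h) + complexity h := by
  intro c
  obtain ⟨κ, hcon⟩ := stub_jssContraction
  obtain ⟨d, n₁, hhard⟩ := stub_blockArsenal c κ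
  obtain ⟨e, n₀, hS⟩ := stub_subexpRigid d
  refine ⟨e, n₀ + n₁, ?_⟩
  intro n hn h hh hcard
  obtain ⟨h', hh', htor, hsupp, hle1, -⟩ := stub_torusSupport n h hh
  by_contra hlt
  have hle : complexity (perPoly (Fin n) ℝ≥0 * h) + complexity h ≤
      2 ^ ((Nat.log 2 n + c) ^ c) := not_lt.mp hlt
  have hcard' : h'.support.card ≤ 2 ^ (n / (Nat.log 2 n + e) ^ e) :=
    le_trans (Finset.card_le_card hsupp) hcard
  obtain ⟨b, k, m, eR, eC, w, u, hb, hcut, hsingle⟩ := hS n (by omega) h' hh' htor hcard'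
  -- face descent: `x^u · per_G` is (up to one gate) no more expensive than `per · h'`
  have hdesc := stub_faceDescent n (placedBlock eR eC) w h' u hcut hh' hsingle
  have h1 : complexity (monomial u (1 : ℝ≥0) * facePer (placedBlock eR eC)) ≤
      2 ^ ((Nat.log 2 n + c) ^ c) + 1 :=
    calc complexity (monomial u (1 : ℝ≥0) * facePer (placedBlock eR eC))
        ≤ complexity (perPoly (Fin n) ℝ≥0 * h') + 1 := hdesc
      _ ≤ complexity (perPoly (Fin n) ℝ≥0 * h) + 1 := Nat.add_le_add_right hle1 1
      _ ≤ 2 ^ ((Nat.log 2 n + c) ^ c) + 1 :=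
          Nat.add_le_add_right (le_trans (Nat.le_add_right _ _) hle) 1
  -- JSS contraction: strip the monomial at polynomial cost
  have h2 : complexity (facePer (placedBlock eR eC)) ≤
      ((n + 2) * (2 ^ ((Nat.log 2 n + c) ^ c) + 3)) ^ κ :=
    calc complexity (facePer (placedBlock eR eC))
        ≤ ((n + 2) * (complexity (monomial u (1 : ℝ≥0) * facePer (placedBlock eR eC)) + 2)) ^ κ :=
          hcon n (facePer (placedBlock eR eC)) u
      _ ≤ ((n + 2) * (2 ^ ((Nat.log 2 n + c) ^ c) + 3)) ^ κ :=
          Nat.pow_le_pow_left (Nat.mul_le_mul_left _ (by omega)) κ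
  -- the placed block face is harder than that
  have h3 := hhard n (by omega) b k m eR eC hb
  exact absurd (lt_of_lt_of_le h3 h2) (lt_irrefl _)

end Summit.ValiantsHypothesis.ValiantsHypothesis.Theorems.DivisionGapPerDivisionHard

end
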